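import Literature.NumberTheory.EllipticCurves.Kato2004.LocPKernelRankOneProofs

set_option linter.dupNamespace false
set_option autoImplicit false

/-! # Route `CongruentShaFreeCut` (rung S2) — crux `AnalyticRankOneOfRankOneFiniteShaTwo`
(stmt-BirchSwinnertonDyer-19080): LEVELWISE inputs of (R1) «rank one ∧ `Ш[p^∞]` finite ⇒
`rank_{ℤ_p} H¹(ℤ[1/p], T_pW) ≤ 1» — rank-one Selmer classes are integer multiples of ONE Kummer class up to a
uniform exponent, and integral `T_pW`-classes reduce into the Selmer local conditions away from `p` up to a
uniform exponent (part 2 of 3; parts 1/3 = `Theorems/CongruentShaFreeCutSelmerRelaxationUniform.lean`,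
`Theorems/CongruentShaFreeCutIntegralH1RankLeOne.lean`)

Cell `bsd-cn100`, prover seat `bsd-cn100-s2-c3` g11 (plan g18 RULING-2 (2)).  Supports, does not close,
stmt-BirchSwinnertonDyer-19080.  Theorems only (no definition, no named fact, no `sorry`).

## Contents

* §2 (any number field `K : Type`) **`exists_uniform_nsmul_eq_zsmul_kummerMapTorsion`**: if `rank_ℤ W(K) = 1`
  and `Ш(W)[p^∞]` is finite there are ONE `B ≠ 0` and ONE `P₁ ∈ W(K)` such that for every level
  `n = p^k` and every `d ∈ Sel⁽ⁿ⁾(W/K)`, `B • d = a • κ_n(P₁)` with `a ∈ ℤ` — finite-level Kummer theory as in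
  `exists_uniform_nsmul_eq_zero_of_mem_selmerGroup_of_res_eq_zero` (Skinner 2020 §2.2), without the local
  hypothesis (`B = #Ш[p^∞] · m₀`).
* §3 (over `ℚ`) **`exists_uniform_nsmul_reduction_mem_selmerLocalKer`**: ONE `T ≠ 0` such that for every
  integral `x ∈ H¹(Γ_ℚ, T_pW)` (`Kato2004.integralH1 … ⊤`) and every `k` the reduction
  `c_k ∈ H¹(ℚ, W[p^k])` of `x` has `T • c_k` in the `p^k`-Selmer local condition at every finite `v ≠ p` and
  every infinite place — verbatim Step 2 of the conjunct-11 assembly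
  (`Kato2004.locP_kernel_isTorsion_of_rankOne_of_localBound`) without the condition at `p`.

HONEST FRAMING: bookkeeping over tree theorems; no named fact; nothing about the Perrin-Riou formula, crux B,
the leaf or BSD.  PARTITION: none — RANK axis.

References: [Skinner2020] §2.2; [SilvermanAEC2009] VIII.§2, X.§4; [MilneADT2006] I Prop. 3.8, Lemma 3.3;
[Kato2004Asterisque] §8.2, Lemma 8.5. -/

noncomputable section

open scoped Classical NumberField

namespace Summit.BirchSwinnertonDyer.BirchSwinnertonDyer.Theorems.CongruentShaFreeCutSelmerRankOneLevelwise

open CategoryTheory Field IsDedekindDomain NumberField Function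
open WeierstrassCurve (geomPoints geomTorsion galH1Torsion selmerLocalKer selmerGroup torsionPoints
  torsionGaloisModule kummerMapTorsion kummerMapTorsion_mem_selmerLocalKer)
open Literature.NumberTheory.GaloisRepresentations
open Literature.NumberTheory.EllipticCurves Literature.NumberTheory.EllipticCurves.Kato2004
open Literature.NumberTheory.EllipticCurves.Kato2004.EulerSystemValues

/-! ## §2 Rank one: every Selmer class is, after a uniform multiple, an integer multiple of `κ(P₁)` -/

section SelmerStructure

variable {K : Type} [Field K] [NumberField K] (W : WeierstrassCurve K) [W.IsElliptic] (p : ℕ) [Fact p.Prime]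

/-- **Rank one and finite `Ш[p^∞]`: ONE `B ≠ 0` and ONE point `P₁` such that for every level `p^k` and
every `d ∈ Sel^{(p^k)}(W/K)`, `B • d = a • κ_{p^k}(P₁)` for an INTEGER `a`** (`B = #Ш[p^∞] · m₀`, `m₀` the
torsion exponent of `W(K)`): `#Ш[p^∞] • d` dies in `H¹(K, W)` hence is a Kummer class `κ(P)`,
`P = aP₁ + t`, and `m₀ • κ(t) = 0`.  Finite-level Kummer theory exactly as in
`exists_uniform_nsmul_eq_zero_of_mem_selmerGroup_of_res_eq_zero` (Skinner 2020 §2.2), without the local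
hypothesis. [cite: Skinner2020, §2.2 (Lemma rank1lemma)] [cite: SilvermanAEC2009, VIII.§2 and X.§4] -/
theorem exists_uniform_nsmul_eq_zsmul_kummerMapTorsion (hrank : W.mordellWeilRank = 1)
    [Finite (AddCommGroup.primaryComponent W.sha p)] :
    ∃ (B : ℕ) (P₁ : W.toAffine.Point), B ≠ 0 ∧
      ∀ (n : ℤ) (hdiv : ∀ P : geomPoints W, ∃ Q : geomPoints W, n • Q = P),
        (∃ k : ℕ, n = (p : ℤ) ^ k) → ∀ d : galH1Torsion W n, d ∈ selmerGroup W n →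
          ∃ a : ℤ, B • d = a • kummerMapTorsion W n hdiv P₁ := by
  have hp : p.Prime := Fact.out
  haveI : PerfectField K := PerfectField.ofCharZero
  obtain ⟨P₁, -, hgen⟩ := exists_generator_of_mordellWeilRank_eq_one W hrank
  obtain ⟨m₀, hm₀, hm₀t⟩ := exists_nsmul_eq_zero_of_isOfFinAddOrder W
  set s : ℕ := Nat.card (AddCommGroup.primaryComponent W.sha p) with hs
  have hs0 : s ≠ 0 := Nat.card_pos.ne'
  refine ⟨s * m₀, P₁, Nat.mul_ne_zero hs0 hm₀, fun n hdiv ⟨k, hk⟩ d hd => ?_⟩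
  have hn0 : n ≠ 0 := by rw [hk]; exact pow_ne_zero k (Int.natCast_ne_zero.mpr hp.ne_zero)
  -- (i) `s • d` dies in `H¹(K, W)`: its image lies in `Ш ∩ H¹(K,W)[n] ⊆ Ш[p^∞]`
  have himg : WeierstrassCurve.torsionH1ToH1 W _ d ∈ W.sha ⊓ AddSubgroup.torsionBy W.galH1 n := by
    rw [← W.map_torsionH1ToH1_selmerGroup_holds hn0]
    exact AddSubgroup.mem_map_of_mem _ hd
  have hprim : (⟨WeierstrassCurve.torsionH1ToH1 W _ d, himg.1⟩ : W.sha) ∈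
      AddCommGroup.primaryComponent W.sha p := by
    refine (AddCommGroup.mem_primaryComponent).mpr ⟨k, Subtype.ext ?_⟩
    have h2 : n • WeierstrassCurve.torsionH1ToH1 W _ d = 0 := himg.2
    rw [AddSubgroupClass.coe_nsmul, ZeroMemClass.coe_zero, ← natCast_zsmul, Nat.cast_pow, ← hk]
    exact h2
  have hsd : WeierstrassCurve.torsionH1ToH1 W _ (s • d) = 0 := by
    have h := card_nsmul_eq_zero' (G := AddCommGroup.primaryComponent W.sha p)
      (x := ⟨⟨WeierstrassCurve.torsionH1ToH1 W _ d, himg.1⟩, hprim⟩)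
    have h' := congrArg (fun z : AddCommGroup.primaryComponent W.sha p => ((z : W.sha) : W.galH1)) h
    simp only [AddSubgroupClass.coe_nsmul, ZeroMemClass.coe_zero] at h'
    rw [map_nsmul]
    exact h'
  -- (ii) so `s • d = κ_n(P)`, `P = a P₁ + t`
  obtain ⟨P, hP⟩ := WeierstrassCurve.mem_range_kummerMapTorsion_of_torsionH1ToH1_eq_zero W _ hdiv (s • d) hsd
  obtain ⟨a, t, ht, rfl⟩ := hgen P
  refine ⟨m₀ * a, ?_⟩
  have hPart2 : m₀ • kummerMapTorsion W _ hdiv t = 0 := by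
    rw [← map_nsmul, hm₀t t ht, map_zero]
  calc (s * m₀) • d = m₀ • (s • d) := by rw [mul_comm, mul_nsmul']
    _ = m₀ • kummerMapTorsion W _ hdiv (a • P₁ + t) := by rw [hP]
    _ = m₀ • (a • kummerMapTorsion W _ hdiv P₁) + m₀ • kummerMapTorsion W _ hdiv t := by
        rw [map_add, map_zsmul, smul_add]
    _ = (m₀ * a : ℤ) • kummerMapTorsion W _ hdiv P₁ := by
        rw [hPart2, add_zero, mul_zsmul, natCast_zsmul]

end SelmerStructure

/-! ## §3 Integral classes of `H¹(⊤, T_pW)` reduce into `H¹_{𝓛, ⊤ at p}` after a uniform multiple -/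

section Integral

variable (W : WeierstrassCurve ℚ) [W.IsElliptic] (p : ℕ) [Fact p.Prime]
  [ContinuousSMul ℤ_[p] (W.tateModule p)]

/-- **Integral classes satisfy the Kummer condition away from `p`, up to ONE exponent, at every level.**
There is `T ≠ 0` such that for every integral `x ∈ H¹(Γ_ℚ, T_pW)` (`Kato2004.integralH1 … ⊤`) and every
`k`, the reduction `c_k ∈ H¹(ℚ, W[p^k])` of `x` satisfies `T • c_k ∈` the `p^k`-Selmer local condition at
every finite `v ≠ p` and every infinite place — verbatim the conjunct-11 assembly
(`locP_kernel_isTorsion_of_rankOne_of_localBound`, Step 2) without the condition at `p`: unramified at good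
`v ≠ p` (Milne I.3.8), the bad places after the uniform exponent
`exists_uniform_nsmul_mem_selmerLocalKer_of_mem_unramifiedKer`, the real place after `2`.
[cite: MilneADT2006, Ch. I Prop. 3.8 and Lemma 3.3] [cite: Kato2004Asterisque, §8.2 and Lemma 8.5 (pp. 180–184)] -/
theorem exists_uniform_nsmul_reduction_mem_selmerLocalKer :
    ∃ T : ℕ, T ≠ 0 ∧ ∀ (x : H1 (tateRep W p) ⊤), x ∈ integralH1 (tateRep W p) p ⊤ → ∀ k : ℕ,
      (∀ v : HeightOneSpectrum (𝓞 ℚ), v ≠ primePlace p →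
        T • (ofTopSubgroup (W.torsionGaloisModule ((p : ℤ) ^ k)).toTopRep 1).hom
            (reduceH1Pk W p k ⊤ x) ∈ selmerLocalKer W (v.adicCompletion ℚ) ((p : ℤ) ^ k)) ∧
      (∀ w : InfinitePlace ℚ,
        T • (ofTopSubgroup (W.torsionGaloisModule ((p : ℤ) ^ k)).toTopRep 1).hom
            (reduceH1Pk W p k ⊤ x) ∈ selmerLocalKer W w.Completion ((p : ℤ) ^ k)) := by
  have hp : p.Prime := Fact.out
  obtain ⟨S, hS⟩ : ∃ S : Finset (HeightOneSpectrum (𝓞 ℚ)),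
      ∀ v, v ∉ S → W.HasGoodReductionAt v := by
    have h := WeierstrassCurve.eventually_hasGoodReductionAt W
    rw [Filter.eventually_cofinite] at h
    exact ⟨h.toFinset, fun v hv => by_contra fun hbad => hv (h.mem_toFinset.mpr hbad)⟩
  choose t ht0 ht using fun v : HeightOneSpectrum (𝓞 ℚ) =>
    exists_uniform_nsmul_mem_selmerLocalKer_of_mem_unramifiedKer W v
  refine ⟨2 * ∏ v ∈ S, t v,
    Nat.mul_ne_zero two_ne_zero (Finset.prod_ne_zero_iff.mpr fun v _ => ht0 v), fun x hx k => ?_⟩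
  have hn0 : ((p : ℤ) ^ k) ≠ 0 := pow_ne_zero k (Int.natCast_ne_zero.mpr hp.ne_zero)
  have hrint : reduceH1Pk W p k ⊤ x ∈ integralH1 (W.torsionGaloisModule ((p : ℤ) ^ k)) p ⊤ :=
    reduceH1Pk_mem_integralH1 W p k ⊤ hx
  have hunr : ∀ v : HeightOneSpectrum (𝓞 ℚ),
      ((Rat.HeightOneSpectrum.primesEquiv v : Nat.Primes) : ℕ) ≠ p →
        ∀ 𝔓 ∈ v.primesAbove,
          (ofTopSubgroup (W.torsionGaloisModule ((p : ℤ) ^ k)).toTopRep 1).hom (reduceH1Pk W p k ⊤ x) ∈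
            unramifiedKer (geomTorsion W ((p : ℤ) ^ k)) 𝔓 :=
    fun v hv 𝔓 h𝔓 => ofTopSubgroup_mem_unramifiedKer_of_mem_integralH1 W p _ hrint hv h𝔓
  have hne : ∀ v : HeightOneSpectrum (𝓞 ℚ), v ≠ primePlace p →
      ((Rat.HeightOneSpectrum.primesEquiv v : Nat.Primes) : ℕ) ≠ p := by
    intro v hv h
    apply hv
    apply (Rat.HeightOneSpectrum.primesEquiv (R := 𝓞 ℚ)).injective
    rw [primesEquiv_primePlace]
    exact Subtype.ext h
  refine ⟨fun v hvp => ?_, fun w => ?_⟩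
  · by_cases hvS : v ∈ S
    · have h1 := ht v _ hn0 _ (hunr v (hne v hvp))
      obtain ⟨q, hq⟩ : t v ∣ 2 * ∏ v ∈ S, t v :=
        (Finset.dvd_prod_of_mem t hvS).trans (Dvd.intro_left 2 rfl)
      rw [hq, mul_comm, mul_nsmul']
      exact AddSubgroup.nsmul_mem _ h1 q
    · obtain ⟨𝔓, h𝔓⟩ := v.primesAbove_nonempty
      exact AddSubgroup.nsmul_mem _
        (W.unramifiedKer_le_selmerLocalKer_of_hasGoodReductionAt (hS v hvS) _ h𝔓
          (hunr v (hne v hvp) 𝔓 h𝔓)) _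
  · rw [mul_comm, mul_nsmul']
    exact AddSubgroup.nsmul_mem _ (two_nsmul_mem_selmerLocalKer_infinitePlace W w _) _

end Integral

end Summit.BirchSwinnertonDyer.BirchSwinnertonDyer.Theorems.CongruentShaFreeCutSelmerRankOneLevelwise

end
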